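/-
Origin: expansion seat `planner-pub-hodgecm-toy2-g3-0`, handover #4 2026-08-18T06:47:17Z (`HOME/pub-hodgecm-toy2-g3/lean/Toy2g3/TruncAlgDual.lean`, md5 52f8252c, 239 lines);
landed by the gen-7 packager in gate run 25 as `HodgeCM/Model/Toy/TruncAlgDual.lean` (import ^import Toy2g3\.(TruncAlgMilne|TruncAlgAtExt|TruncAlgAt|TruncAlgDual|TruncAlgCM|TruncAlgExt)\b→import HodgeCM.Model.Toy.\1 ×1).
-/
/-
Copyright: pub-hodgecm formalisation cell (harness21, 2026). New file (not vendored).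
Origin: HOME/pub-hodgecm-toy2-g3/lean/Toy2g3/TruncAlgDual.lean — session planner-pub-hodgecm-toy2-g3-0 (unit pub-hodgecm-toy2-g3,
CONSISTENCY seat 2, part (6a)(ii), generation 3).  WIP module `Toy2g3.TruncAlgDual`; intended final place
`HodgeCM/Model/Toy/TruncAlgDual.lean` (module `HodgeCM.Model.Toy.TruncAlgDual`; kind L5 consistency / non-vacuity layer).
WIP import to rewrite on landing: `import Toy2g3.TruncAlgMilne` ↦ `import HodgeCM.Model.Toy.TruncAlgMilne` (this seat, HANDOVER #2).
-/
import Summits.HodgeConjecture.HodgeCM.Model.Toy.TruncAlgMilne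
import Summits.HodgeConjecture.HodgeCM.Proofs.Pohlmann.DegreeZero

/-!
# [QW8] Thm 2.5 steps (iii)+(v) SURVIVE the codimension-two truncation; the all-degree forms in the toy

`HodgeCM.Model.Toy.TruncAlgMilne` ran the truncation test over the obligations of `qw8Sufficiency_of_steps'` and left
steps (ii) `Qw8ExtProd` and (iii)+(v) `Qw8DualPushPull` undecided.  This file decides (iii)+(v): it HOLDS in `U.truncAlg`
for every model `U` of `ModelAxioms`, N1, N3, F4, F5, F7d, `Fact_dimProd` with `Qw8MilneZero` (all theorems of `toyModel`).

The point is a DEGREE-AWARE form of the dual push-pull (`qw8DualPushPull_deg`, all degrees): for every `e` and every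
algebraic `W` there is `Z` with `a(Z) = a(e) - a(W)`, `Z` algebraic ⇒ `e` algebraic, AND `deg e ≤ deg Z` (the [QW8]
construction `Z = e ⊠ W^∨` only raises degrees; in degree `0` one takes `Z := W̄` resp. `Z := e`, using that degree-`0`
weight vectors have the empty weight — `weightSpace_zero_eq_bot`, M + N3 — hence character `0`).  Under truncation an
algebraic `Z` has codimension `≤ 2`, so `e` has codimension `≤ 2` as well, where `U.truncAlg` and `U` agree.

Consequences (`truncModel := toyModel.truncAlg`): `truncModel_qw8DualPushPull`, and the all-degree toy theorems
`toyModel_qw8DualPushPull`, `toyModel_qw8Steps` (steps (i), (iii)+(v), (iv), (iv)₀ and the bridge hold in `toyModel`).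
So the truncation profile of the five obligations reads: (i) ✓, (iii)+(v) ✓, bridge ✓, (iv)₀ ✓, **(iv) ✗**
(`not_truncModel_qw8Milne`); (ii) `Qw8ExtProd` is not decided in Lean (it should fail for degree reasons: the characters
of codimension-`≤ 2` algebraic weight vectors are not closed under addition).  All proofs kernel-checked; no cited facts.
-/

noncomputable section

open scoped TensorProduct

namespace HodgeCM

open Literature.AlgebraicGeometry.Motives (CMType)

namespace Universe

variable (U : Universe)

/-! ## 1. Degree-0 weight vectors have the empty weight and character `0` -/

section DegreeZero

variable {U} {F : CMField}

/-- A weight vector of degree `0` has the empty weight (M + N3: `weightSpace_zero_eq_bot`). -/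
theorem WVec.S_eq_empty_of_p_eq_zero (M : U.ModelAxioms) (hN3 : U.Fact_pull_H0) (z : U.WVec F) (hp : z.p = 0)
    (j : Fin (z.n + 1)) : z.S j = ∅ := by
  by_contra h
  have hne : (z.S j).Nonempty := Finset.nonempty_iff_ne_empty.mpr h
  obtain ⟨n, Θ, p, S, x, hx0, hxw⟩ := z
  change p = 0 at hp
  subst hp
  have hmem : x ∈ U.weightSpace F Θ S 0 := (mem_weightSpace_iff _ _ _ _ _).mpr hxw
  rw [weightSpace_zero_eq_bot M hN3 hne, Submodule.mem_bot] at hmem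
  exact hx0 hmem

/-- Hence its Lefschetz character vanishes. -/
theorem WVec.achar_eq_zero_of_p_eq_zero (M : U.ModelAxioms) (hN3 : U.Fact_pull_H0) (z : U.WVec F) (hp : z.p = 0) :
    z.achar = 0 := by
  have hS := WVec.S_eq_empty_of_p_eq_zero M hN3 z hp
  show lefChar z.Θ z.S = 0
  unfold lefChar
  exact Finset.sum_eq_zero fun j _ => by rw [hS j, Finset.sum_empty]

end DegreeZero

/-! ## 2. The degree-aware dual push-pull, in all degrees -/

/-- **[QW8] Thm 2.5 (iii)+(v) in ALL degrees, with degree control**: from `ModelAxioms`, N1, N3, F4, F5, F7d,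
`Fact_dimProd` and the degree-0 residue `Qw8MilneZero`.  Positive degrees: the construction of
`qw8DualPushPullPos_of_descent` (`Z := p_Y^* e ∪ p_{Y'}^* W^∨`, of degree `deg e + deg W^∨`); `deg W = 0` or `W` of full
weight: `a(W) = 0` and `Z := e`; `deg e = 0`: `e` is algebraic outright and `Z := W̄`. -/
theorem qw8DualPushPull_deg (M : U.ModelAxioms) (hN1 : U.Fact_cupExterior) (hN3 : U.Fact_pull_H0) (h4 : U.Fact_cupAlg)
    (h5 : U.Fact_cupAssoc) (h7d : U.Fact_gysinDescent) (hd : U.Fact_dimProd) (hM0 : U.Qw8MilneZero) :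
    ∀ (F : CMField), IsGalois ℚ F → 6 ≤ Module.finrank ℚ F → ∀ (e W : U.WVec F), W.IsAlg →
      ∃ Z : U.WVec F, Z.achar = e.achar - W.achar ∧ e.p ≤ Z.p ∧ (Z.IsAlg → e.IsAlg) := by
  classical
  intro F hG h6 e W hW
  by_cases hep : e.p = 0
  · refine ⟨W.conj, ?_, by rw [hep]; exact Nat.zero_le _, fun _ => hM0 F hG h6 e hep⟩
    rw [WVec.achar_conj, WVec.achar_eq_zero_of_p_eq_zero M hN3 e hep, zero_sub]
  by_cases hWp : W.p = 0
  · refine ⟨e, ?_, le_rfl, id⟩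
    rw [WVec.achar_eq_zero_of_p_eq_zero M hN3 W hWp, sub_zero]
  by_cases hSW : W.S = fun _ => Finset.univ
  · refine ⟨e, ?_, le_rfl, id⟩
    rw [show W.achar = lefChar W.Θ W.S from rfl, hSW, lefChar_univ_eq_zero, sub_zero]
  obtain ⟨n, Θ, p, S, x, hx0, hxw⟩ := e
  obtain ⟨m, Θ', q, S', w, hw0, hww⟩ := W
  change w ∈ U.algC (U.cmProd F Θ') q at hW
  change ¬ p = 0 at hep
  change ¬ q = 0 at hWp
  have hep' : 0 < p := Nat.pos_of_ne_zero hep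
  have hWp' : 0 < q := Nat.pos_of_ne_zero hWp
  change ¬(S' = fun _ => Finset.univ) at hSW
  let Ξ : Fin (n + 1 + (m + 1)) → CMType F := Fin.append Θ Θ'
  have hA : blkA Ξ = Θ := blkA_append Θ Θ'
  have hB : blkB Ξ = Θ' := blkB_append Θ Θ'
  obtain ⟨x₂, h0x, hwx, hax⟩ := U.transport_wvec hA.symm p S x
  obtain ⟨w₂, h0w, hww₂, haw⟩ := U.transport_wvec hB.symm q S' w
  obtain ⟨pA, pB, hP⟩ := U.blockPair_exists M.pull_id M.pull_comp M.lift F n m Ξ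
  obtain ⟨hq, w', hw', hww', -⟩ := U.weightDual_of_descent (blkB Ξ) M hN1 h5 hd q S' w₂
    (fun h => hw0 (h0w.mpr h)) (hww₂.mp hww) hWp' hSW
  have h6' : 2 * (U.dim (U.cmProd F (blkB Ξ)) - q) + 2 * q = 2 * U.dim (U.cmProd F (blkB Ξ)) := by omega
  have hdeg : 2 * p + 2 * (U.dim (U.cmProd F (blkB Ξ)) - q) = 2 * (p + (U.dim (U.cmProd F (blkB Ξ)) - q)) := by
    omega
  have hZ0 : U.cupC (U.cmProd F Ξ) (2 * p) (2 * (U.dim (U.cmProd F (blkB Ξ)) - q)) (U.pullC pA (2 * p) x₂)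
      (U.pullC pB (2 * (U.dim (U.cmProd F (blkB Ξ)) - q)) w') ≠ 0 :=
    U.box_ne_zero_of_descent Ξ M hN1 h5 hd h7d hP (fun h => hx0 (h0x.mpr h)) w' w₂ h6' hww'
  have hZw := U.isWeightVector_box' Ξ M hN1 hP (by omega) (by omega) (hwx.mp hxw) hw'
  refine ⟨⟨n + 1 + m, Ξ, p + (U.dim (U.cmProd F (blkB Ξ)) - q), (Fin.append S (fun i => (S' i)ᶜ) :), U.castC _ hdeg
      (U.cupC (U.cmProd F Ξ) (2 * p) (2 * (U.dim (U.cmProd F (blkB Ξ)) - q)) (U.pullC pA (2 * p) x₂)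
        (U.pullC pB (2 * (U.dim (U.cmProd F (blkB Ξ)) - q)) w')),
      fun h => hZ0 ((LinearEquiv.map_eq_zero_iff _).mp h), U.isWeightVector_castC F Ξ _ hdeg hZw⟩, ?_, ?_, ?_⟩
  · show lefChar Ξ (Fin.append S (fun i => (S' i)ᶜ) :) = lefChar Θ S - lefChar Θ' S'
    rw [lefChar_append, lefChar_congr hA, lefChar_congr hB,
      eq_neg_of_add_eq_zero_right (lefChar_add_lefChar_compl Θ' S'), sub_eq_add_neg]
  · show p ≤ p + (U.dim (U.cmProd F (blkB Ξ)) - q)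
    exact Nat.le_add_right _ _
  · intro hZalg
    change U.castC _ hdeg (U.cupC (U.cmProd F Ξ) (2 * p) (2 * (U.dim (U.cmProd F (blkB Ξ)) - q))
      (U.pullC pA (2 * p) x₂) (U.pullC pB (2 * (U.dim (U.cmProd F (blkB Ξ)) - q)) w')) ∈
        U.algC (U.cmProd F Ξ) (p + (U.dim (U.cmProd F (blkB Ξ)) - q)) at hZalg
    show x ∈ U.algC (U.cmProd F Θ) p
    refine hax.mpr ?_
    have hpB : U.pullC pB (2 * q) w₂ ∈ U.algC (U.cmProd F Ξ) q := U.pullC_mem_algC M.pull_alg pB q (haw.mp hW)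
    have hdeg1 : 2 * (p + (U.dim (U.cmProd F (blkB Ξ)) - q)) + 2 * q =
        2 * (p + (U.dim (U.cmProd F (blkB Ξ)) - q) + q) := by omega
    have hA1 := U.cupC_mem_algC h4 _ (p + (U.dim (U.cmProd F (blkB Ξ)) - q)) q hZalg hpB hdeg1
    have hidx : p + (U.dim (U.cmProd F (blkB Ξ)) - q) + q = p + U.dim (U.cmProd F (blkB Ξ)) := by omega
    have hA2 := (U.castC_mem_algC_iff (U.cmProd F Ξ) hidx (by omega) _).mpr hA1
    obtain ⟨ω, hω⟩ : ∃ ω, ω = U.castC _ h6' (U.cupC _ (2 * (U.dim (U.cmProd F (blkB Ξ)) - q)) (2 * q) w' w₂) :=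
      ⟨_, rfl⟩
    have hωback : U.cupC _ (2 * (U.dim (U.cmProd F (blkB Ξ)) - q)) (2 * q) w' w₂ = U.castC _ h6'.symm ω := by
      rw [hω, castC_castC, castC_self]
    have hω0 : ω ≠ 0 := by rw [hω]; exact (LinearEquiv.map_ne_zero_iff _).mpr hww'
    have calc1 : U.cupC (U.cmProd F Ξ) (2 * (p + (U.dim (U.cmProd F (blkB Ξ)) - q))) (2 * q) (U.castC _ hdeg
        (U.cupC (U.cmProd F Ξ) (2 * p) (2 * (U.dim (U.cmProd F (blkB Ξ)) - q)) (U.pullC pA (2 * p) x₂)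
          (U.pullC pB (2 * (U.dim (U.cmProd F (blkB Ξ)) - q)) w')))
        (U.pullC pB (2 * q) w₂) =
        U.castC _ (by omega : 2 * p + 2 * U.dim (U.cmProd F (blkB Ξ)) = 2 * (p + (U.dim (U.cmProd F (blkB Ξ)) - q)) + 2 * q)
          (U.cupC (U.cmProd F Ξ) (2 * p) (2 * U.dim (U.cmProd F (blkB Ξ))) (U.pullC pA (2 * p) x₂)
            (U.pullC pB (2 * U.dim (U.cmProd F (blkB Ξ))) ω)) := by
      rw [cupC_castC_left, cupC_assoc U h5, ← pullC_cupC U M.pull_cup, hωback, pullC_castC, cupC_castC_right]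
      simp only [castC_castC]
    rw [calc1] at hA2
    simp only [castC_castC] at hA2
    exact U.mem_algC_of_boxC_mem Ξ M hN1 hd h7d hP hω0 (by omega) hA2

/-- In particular **(iii)+(v) in all degrees** from the same facts. -/
theorem qw8DualPushPull_of_descent_all (M : U.ModelAxioms) (hN1 : U.Fact_cupExterior) (hN3 : U.Fact_pull_H0)
    (h4 : U.Fact_cupAlg) (h5 : U.Fact_cupAssoc) (h7d : U.Fact_gysinDescent) (hd : U.Fact_dimProd)
    (hM0 : U.Qw8MilneZero) : U.Qw8DualPushPull := fun F hG h6 e W hW => by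
  obtain ⟨Z, ha, -, hi⟩ := U.qw8DualPushPull_deg M hN1 hN3 h4 h5 h7d hd hM0 F hG h6 e W hW
  exact ⟨Z, ha, hi⟩

/-! ## 3. (iii)+(v) survive truncation -/

set_option smartUnfolding false in
/-- **`Qw8DualPushPull` HOLDS in `U.truncAlg`** (for `U` with `ModelAxioms`, N1, N3, F4, F5, F7d, `Fact_dimProd`,
`Qw8MilneZero`): run the degree-aware dual push-pull in `U`; an algebraic `Z` of the truncation has codimension `≤ 2`,
hence so has `e`, and there `U.truncAlg` and `U` agree. -/
theorem truncAlg_qw8DualPushPull (M : U.ModelAxioms) (hN1 : U.Fact_cupExterior) (hN3 : U.Fact_pull_H0)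
    (h4 : U.Fact_cupAlg) (h5 : U.Fact_cupAssoc) (h7d : U.Fact_gysinDescent) (hd : U.Fact_dimProd)
    (hM0 : U.Qw8MilneZero) : U.truncAlg.Qw8DualPushPull := by
  intro F hG h6 e' W' hW'
  have hWp : W'.p ≤ 2 := by
    by_contra h
    exact WVec.not_isAlg_truncAlg W' (by omega) hW'
  have hW : (WVec.ofTruncAlg W').IsAlg := (WVec.isAlg_ofTruncAlg_iff W' hWp).mpr hW'
  obtain ⟨Z, hZa, hZp, hZimp⟩ :=
    U.qw8DualPushPull_deg M hN1 hN3 h4 h5 h7d hd hM0 F hG h6 (WVec.ofTruncAlg e') (WVec.ofTruncAlg W') hW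
  refine ⟨Z.toTruncAlg, hZa, fun hZ' => ?_⟩
  have hZp2 : Z.p ≤ 2 := by
    by_contra h
    exact WVec.not_isAlg_truncAlg Z.toTruncAlg (by change 2 < Z.p; omega) hZ'
  have hZ : Z.IsAlg := (WVec.isAlg_toTruncAlg_iff Z hZp2).mp hZ'
  have hep : e'.p ≤ 2 := by
    change (WVec.ofTruncAlg e').p ≤ 2
    omega
  exact (WVec.isAlg_ofTruncAlg_iff e' hep).mp (hZimp hZ)

end Universe

/-! ## 4. The toy instances -/

namespace Toy

open Universe

/-- **[QW8] (iii)+(v) in ALL degrees in the exterior toy model.** -/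
theorem toyModel_qw8DualPushPull : toyModel.Qw8DualPushPull :=
  toyModel.qw8DualPushPull_of_descent_all toyModel_modelAxioms toyModel_fact_cupExterior toyModel_fact_pull_H0
    fact_cupAlg (fact_cupAssoc exteriorHodgeData) toyModel_fact_gysinDescent toyModel_fact_dimProd toyModel_qw8MilneZero

/-- **[QW8] (iii)+(v) HOLDS in `truncModel`.** -/
theorem truncModel_qw8DualPushPull : truncModel.Qw8DualPushPull :=
  toyModel.truncAlg_qw8DualPushPull toyModel_modelAxioms toyModel_fact_cupExterior toyModel_fact_pull_H0 fact_cupAlg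
    (fact_cupAssoc exteriorHodgeData) toyModel_fact_gysinDescent toyModel_fact_dimProd toyModel_qw8MilneZero

/-- The all-degree [QW8] profile of `toyModel`: steps (i), (iii)+(v), (iv), (iv)₀ and the bridge hold (step (ii) in
positive degree is `qw8ExtProdPos_of_descent`). -/
theorem toyModel_qw8Steps :
    toyModel.Qw8Conj ∧ toyModel.Qw8DualPushPull ∧ toyModel.Qw8Milne ∧ toyModel.Qw8MilneZero ∧ toyModel.Qw8FaceBridge :=
  ⟨toyModel.qw8Conj_holds, toyModel_qw8DualPushPull, toyModel_qw8Milne_of_descent, toyModel_qw8MilneZero,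
    qw8FaceBridge_holds toyModel_modelAxioms⟩

/-- **The truncation profile of the [QW8] obligations**: in `truncModel` steps (i), (iii)+(v), (iv)₀ and the bridge
HOLD and Milne's step (iv) FAILS (with it F4 and `Qw8Sufficiency`). -/
theorem truncModel_qw8Steps :
    (truncModel.Qw8Conj ∧ truncModel.Qw8DualPushPull ∧ truncModel.Qw8MilneZero ∧ truncModel.Qw8FaceBridge) ∧
      (¬ truncModel.Qw8Milne ∧ ¬ truncModel.Qw8MilnePos ∧ ¬ truncModel.Fact_cupAlg ∧ ¬ truncModel.Qw8Sufficiency) :=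
  ⟨⟨truncModel_qw8Conj, truncModel_qw8DualPushPull, truncModel_qw8MilneZero, truncModel_qw8FaceBridge⟩,
    ⟨not_truncModel_qw8Milne, not_truncModel_qw8MilnePos, not_truncModel_fact_cupAlg, not_truncModel_qw8Sufficiency⟩⟩

/-- **Steps (i), (iii)+(v), (iv)₀ and the bridge together with `ModelAxioms ∧ PohlmannSpan ∧ PohlmannBasis ∧ W_RK4` do
NOT imply Milne's step (iv)** — nor `Qw8Sufficiency`. -/
theorem not_qw8Milne_of_other_steps :
    ¬ ∀ U : Universe, U.ModelAxioms → U.PohlmannSpan → U.PohlmannBasis → U.W_RK4 → U.Qw8Conj → U.Qw8DualPushPull →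
      U.Qw8MilneZero → U.Qw8FaceBridge → U.Qw8Milne :=
  fun h => not_truncModel_qw8Milne (h truncModel truncModel_modelAxioms truncModel_pohlmannSpan truncModel_pohlmannBasis
    truncModel_w_rk4 truncModel_qw8Conj truncModel_qw8DualPushPull truncModel_qw8MilneZero truncModel_qw8FaceBridge)

/-- (Ported verbatim from the HodgeCMPerL package; no docstring in the source.) -/
theorem not_qw8Sufficiency_of_other_steps :
    ¬ ∀ U : Universe, U.ModelAxioms → U.PohlmannSpan → U.PohlmannBasis → U.W_RK4 → U.Qw8Conj → U.Qw8DualPushPull →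
      U.Qw8MilneZero → U.Qw8FaceBridge → U.Qw8Sufficiency :=
  fun h => not_truncModel_qw8Sufficiency (h truncModel truncModel_modelAxioms truncModel_pohlmannSpan
    truncModel_pohlmannBasis truncModel_w_rk4 truncModel_qw8Conj truncModel_qw8DualPushPull truncModel_qw8MilneZero
    truncModel_qw8FaceBridge)

end Toy

end HodgeCM

end
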